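import Summits.FinalStateConjecture.FinalStateConjecture.Theses.StarvedNecks
import Summits.FinalStateConjecture.FinalStateConjecture.Theses.PhaseMixingCapture
import Summits.FinalStateConjecture.FinalStateConjecture.Theorems.StarvedNecksHonestFixedRadiusSettlingOfT
import Summits.FinalStateConjecture.FinalStateConjecture.Theorems.HonestFixedRadiusSettling.Negative.MaximalityLoadBearing
import Summits.FinalStateConjecture.FinalStateConjecture.Theorems.ChannelsResolveTameDevelopmentsR.Negative.SubMinkowskiSettledT2
import Summits.FinalStateConjecture.FinalStateConjecture.Theorems.ChannelsResolveTameDevelopmentsR.Negative.SubMinkowskiPastCut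
import Literature.Geometry.Lorentzian.TameGenericityLocal
import Literature.Geometry.Lorentzian.TameGenericityDiagonal
import Literature.Geometry.Lorentzian.TrivialDataAdmissible

/-!
# Disproof attempts on `StarvedNecks.HonestFixedRadiusSettlingT` (crux stmt-FinalStateConjecture-17575)

Standing adversary file of the cdisprove seat `refuter-cdisprove-stmt-FinalStateConjecture-17575-0`
(generation 1, cycle 1, 2026-08-17). `T` = the rev-1 crux `HonestFixedRadiusSettling` (13550) with THREE
edits: (1) `IsChristodoulouGeneric` ↦ `IsTameChristodoulouGeneric` (one fixed sole end, `wDist`-continuity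
at `c = 0`, immersion at `0`); (2) `RaysStayInClosure 𝒟 O` inserted; (3) pairwise distinct hole velocities
`Λᵢ e₀ ≠ Λⱼ e₀` appended. Since `T → HonestFixedRadiusSettling` (landed p131688,
`Theorems.StarvedNecks.Retype.honestFixedRadiusSettling_of_T`), EVERY finding of the rev-1 file
`Cruxes/HonestFixedRadiusSettling/Disproof.lean` §1–§9 and every landed
`Theorems/HonestFixedRadiusSettling/Negative/*` lemma is a test of `T`; this file records only what is NEW
for the three edits. Everything below elaborates; `sorry`-free unless marked NEAR-MISS.

VERDICT (cycle 1): NO KILL. See the `## Findings` index and §5 (why it resists, paper findings).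
LANDED (conversation A): p134976 ACCEPTED, commit 0ff5112a5fa8 —
`Theorems/HonestFixedRadiusSettlingT/Negative/FlatClassCensusT.lean`, namespace
`…Theorems.HonestFixedRadiusSettlingT.Negative.FlatClass` (the Set-valued twin of §0/§1/§3/§4: `velocitySet`,
`settledT`, `T_iff`, `isTameChristodoulouGeneric_zero_of_soleEnd`, `not_isImmersedAtZero_of_eventuallyEq`,
`subDecompK`, `subDev_mem_settledT_iff_future_subset`, `subDev_mem_settledT_iff_hasCompleteNullInfinity`,
`pastCutDev_mem_settledT`, `truncated_not_mem_settledT`, `trivialData_exceptional_withoutIsMaximalT`,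
`curve_obligation_of_TWithoutIsMaximal`, `not_TWithoutIsMaximal_of_not_T`, `mem_velocitySet_of_N_le_one`;
std axioms). Later versions of this workfile may import it once the farm serves its olean. A second
conversation of the same seat (B) is preparing `Negative/KillShapeT.lean` (Set read-back + transfers of the
rev-1 / WCC-Tame batteries) and `Negative/MinkowskiWitnessT.lean` (the rays clause at the maximal candidate
`𝒟₀` itself); see the seat's NOTES.md.

COMPANION NEGATIVE FILES ALREADY IN THE TREE that test the edits of `T` (import them in scratch checks):
`Theorems/WeakCosmicCensorshipTame/Negative/TameMassContinuity.lean` (`ofReal_two_mul_abs_sub_le_wDist`: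
`2|M − M'| ≤ wDist`; `not_isTameDataFamily_of_mass_jump` / `_of_mass_tendsto_atTop`: the burial is not tame —
edit (1) excludes it TWICE, by `wDist` there and by immersion here, §1) and `…/LoadBearing.lean`
(`not_isTameGeneric_iff_exists_trapped`: the tame kill shape with the trapped exceptional datum;
`wccTame_false_without_constraints`, `wccTame_false_without_isMaximal_of`); by `T_false_of_not_tameWCC` (§2)
every refutation of tame WCC obtained there is a refutation of `T`.

## Findings (index)

* §0 READ-BACK. `HonestCore`, `HonestFar` (verbatim the crux's `Hc`/`Hf`), `DistinctVelocities`,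
  `SettlesAtT 𝒟` (the universal conjunct of `P_T` at one development), `SettlesHonestlyT D` (= `P_T D`),
  `TameCodimT m`; `T_iff_tameCodimT_one : HonestFixedRadiusSettlingT ↔ TameCodimT 1` (`Iff.rfl`).
* §1 SHAPE OF ANY KILL (tame version). `not_isTameChristodoulouGeneric_iff`: a refutation is an admissible
  `X`-datum `d` failing `P_T` such that EVERY tame (sole end `e` fixed), immersed-at-`0`, injective admissible
  curve through `d` has another failing member; by the landed arc-locality
  (`TameGenericityLocal.hasTameCodimAtLeastIn_of_local`) only members with `0 < ‖c‖ < ε` matter, so the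
  defect must be LOCALLY UNAVOIDABLE along every tame immersed arc. `not_T_of_forall_not` (nonempty class +
  universal failure), `tameCodimT_zero` (codimension `0` is free: the `1` is the content),
  `not_isImmersedAtZero_of_eventuallyEq` (EDIT (1) IS LOAD-BEARING AGAINST RECEDING FAMILIES: a family whose
  members agree with the base datum near every point for small `c` — pure far-field "brooms", the rev-1
  burial — is NOT immersed at `0`; every `T`-witness has a genuine first-order LOCAL perturbation direction).
* §2 WHAT `T` CONTAINS. `tameWCC_of_T` / `T_false_of_not_tameWCC` (tame weak cosmic censorship,
  item 17269 of route PhaseMixingCapture); `old_of_T` (13550, landed); `T0_of_T` (drop edit (3));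
  `raysGeneric_of_T` (the rays clause alone, tame-generically). Any refutation of one of these kills `T`.
* §3 THE NEW CLAUSES ON THE FLAT MODEL CLASS (kernel-checked census over the landed `SubMinkowski`
  battery of `Theorems/ChannelsResolveTameDevelopmentsR/Negative/`): for EVERY open sub-development
  `η|_U` of the trivial datum, `settlesAtT_subDev_iff : SettlesAtT (η|_U) ↔ {x⁰ ≥ 0} ⊆ U ↔ complete 𝓘⁺`
  — ALL of `T`'s decomposition clauses (`k = 4`, `HonestCore`, `HonestFar`, `O = exteriorOf`,
  `RaysStayInClosure`, distinct velocities) are IDLE relative to complete `𝓘⁺` on the certifiable class;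
  `settlesAtT_pastCutDev` (a NON-maximal development T-settles), `settlesHonestlyT_false_without_isMaximal`
  (the time truncation fails: the guard `IsMaximal →` is load-bearing for `T` exactly as for 13550),
  `raysStayInClosure_subDev` (edit (2) holds on the whole flat class, complete or not: it does not detect
  truncation; its content is multi-region — hidden second infinity — only).
* §4 EDIT (3): `distinctVelocities_of_subsingleton` (vacuous for `N ≤ 1`); what it excludes for `N ≥ 2`
  is exactly the parabolic / comoving pairs (rev-2 repair of NecksCertify, p73407) — paper: codimension 1.
* §6 TARGETS (line `Sketch`, reshape c1): `stub_broom` consistent — no kill (cutoff + charge-matched correction is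
  `wDist`-continuous in the DR class: violations are cutoff-derivatives × ≤ 2 derivatives of the tail); `stub_cleanCore`
  = the open problem.
* §5 WHY IT RESISTS / PAPER FINDINGS (docstrings): (a) no MGHD of a non-trivial datum is constructible,
  so neither `P_T d` nor `¬ P_T d` is provable for any admissible `d`; (b) L1 SHARPENED — `k = 4` versus the
  DR class: admissible far-field trains `h = (1+2M/r)δ + r^{-α} sin(r^{1+q}) (TT)`, `α > 3 + 2q`, make
  `∇²Riem ~ t^{1-α+4q} → ∞` at FIXED radius (`q > 1`), so `P_T` fails at every such datum in every MGHD
  while the summit's `k = 2` survives (`1-α+2q < -2`); the exceptional set of `T` is `wDist`-DENSE; tame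
  arcs leave it only as BROOM + KICK (pure brooms are not immersed, §1); (c) honest flat charts are rigid
  (1+1 reduction: `a(u)+b(v) → 0` on whole slabs forces a Poincaré map), so edit (2) is automatic at
  `N = 0` and bites only hidden second infinities (`M # ℝ³`, BN-4-4) — summit-level, unconstructible;
  (d) edit (3) is codimension-1 physics (parabolic threshold). No barrier of the catalogue applies.
-/

noncomputable section

set_option linter.dupNamespace false

open Literature.Geometry.Lorentzian
open scoped Manifold ContDiff ENNReal Topology
open Filter Set

namespace Summit.FinalStateConjecture.FinalStateConjecture.Cruxes.HonestFixedRadiusSettlingT.Disproof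

open Summit.FinalStateConjecture.FinalStateConjecture.Theses.StarvedNecks
  (HonestFixedRadiusSettlingT HonestFixedRadiusSettling)

/-! ### §0 Named copies of the crux's predicates -/

/-- `HonestCore d R₀` — verbatim the let-bound `Hc` of the crux: sub-extremal holes with
`100 Mᵢ ≤ R₀` and orthochronous boosts (C1); anchoring at every radius `≥ R₀` (C2); relative
closedness of late tube portions for every continuous radius profile (C3); future-oriented flat
chart (C4). -/
def HonestCore (𝓢 : Spacetime.{0} 4) (O : Set 𝓢.carrier) (k : ℕ) (d : FinalStateDecomposition 𝓢 O k)
    (R₀ : ℝ) : Prop :=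
  let B := d.background; let t := fun i ↦ (B i).time; let r := fun i ↦ (B i).radius; let Ψ := d.chart;
  (∀ i, Kerr.IsSubextremal (d.mass i) (d.spin i) ∧ 100 * d.mass i ≤ R₀ ∧
      0 < ((d.motion i).1 : E4 ≃L[ℝ] E4) (E4.basisVector 0) 0) ∧
  (∀ i (ϱ τ₂ : ℝ), R₀ ≤ ϱ → d.τ₀ < τ₂ →
      Ψ i '' {x | d.τ₀ < t i x.1 ∧ t i x.1 < τ₂ ∧ r i x.1 < ϱ} ⊆
        𝓢.metric.causalPast 𝓢.timeOrientation (Ψ i '' (B i).truncTimeSlab ϱ τ₂)) ∧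
  (∀ i (τ' : ℝ) (ϱ : ℝ → ℝ), Continuous ϱ → d.τ₀ < τ' →
      let A := Ψ i '' {x | τ' ≤ t i x.1 ∧ r i x.1 ≤ ϱ (t i x.1)}; closure A ∩ O ⊆ A) ∧
  (∀ y : d.flatDomain, d.τ₀ < y.1 0 →
      𝓢.timeOrientation.IsFutureDirected (mfderiv 𝓘(ℝ, E4) (𝓡 4) d.flatChart y (E4.basisVector 0)))

/-- `HonestFar d R₀` — verbatim the let-bound `Hf` of the crux: flat-late points below later flat
slabs (F1); closures of far flat slabs are flat points (F2); each hole chart eventually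
`C⁰`-close (`1/(10‖Λᵢ‖²)`) to its boosted Kerr on its own Voronoi cell beyond `R₀` (F3). -/
def HonestFar (𝓢 : Spacetime.{0} 4) (O : Set 𝓢.carrier) (k : ℕ) (d : FinalStateDecomposition 𝓢 O k)
    (R₀ : ℝ) : Prop :=
  let B := d.background; let t := fun i ↦ (B i).time; let r := fun i ↦ (B i).radius; let Φ := d.flatChart;
  (∀ τ₂ : ℝ, d.τ₀ < τ₂ → Φ '' {y | d.τ₀ < y.1 0 ∧ y.1 0 < τ₂} ⊆
      𝓢.metric.causalPast 𝓢.timeOrientation (Φ '' (Minkowski.backgroundOn d.flatDomain).timeSlab τ₂)) ∧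
  (∀ τ' : ℝ, d.τ₀ < τ' →
      closure (Φ '' {y | τ' ≤ y.1 0 ∧ ∀ i, d.excision i (y.1 0) + 1 ≤ r i y.1}) ⊆ Φ '' {y | τ' ≤ y.1 0}) ∧
  (∀ i, ∃ T : ℝ, supCkENorm (Subtype.val '' {x : (B i).domain | T ≤ t i x.1 ∧ R₀ ≤ r i x.1 ∧
      ∀ j, j ≠ i → r i x.1 ≤ r j x.1}) 0 (𝓢.deviationExtend (B i) (d.chart i)) ≤
        ENNReal.ofReal (1 / (10 * ‖(((d.motion i).1 : E4 ≃L[ℝ] E4) : E4 →L[ℝ] E4)‖ ^ 2)))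

/-- EDIT (3): the holes' asymptotic four-velocities `Λᵢ e₀` are pairwise distinct. -/
def DistinctVelocities {𝓢 : Spacetime.{0} 4} {O : Set 𝓢.carrier} {k : ℕ}
    (d : FinalStateDecomposition 𝓢 O k) : Prop :=
  ∀ i j : Fin d.N, i ≠ j →
    ((d.motion i).1 : E4 ≃L[ℝ] E4) (E4.basisVector 0) ≠ ((d.motion j).1 : E4 ≃L[ℝ] E4) (E4.basisVector 0)

section Pointwise

variable {X : Type} [TopologicalSpace X] [ChartedSpace E3 X] [IsManifold (𝓡 3) ∞ X] [ConnectedSpace X]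

/-- The universal conjunct of `P_T` at ONE development `𝒟`: complete `𝓘⁺` (sojourn form) and an
honest fixed-radius `C⁴` decomposition of the self-determined exterior with the rays clause
(EDIT (2)) and distinct velocities (EDIT (3)). -/
def SettlesAtT {D : InitialDataSet (𝓡 3) X} (𝒟 : VacuumCauchyDevelopment D) : Prop :=
  HasCompleteNullInfinity 𝒟.toCauchyDevelopment ∧
    ∃ (O : Set 𝒟.carrier) (d : FinalStateDecomposition 𝒟.toSpacetime O 4) (R₀ : ℝ),
      O = exteriorOf 𝒟.toCauchyDevelopment d.charted ∧
        RaysStayInClosure 𝒟.toCauchyDevelopment O ∧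
          HonestCore 𝒟.toSpacetime O 4 d R₀ ∧ HonestFar 𝒟.toSpacetime O 4 d R₀ ∧ DistinctVelocities d

/-- The pointwise property `P_T D` whose TAME Christodoulou-genericity the crux asserts. -/
def SettlesHonestlyT (D : InitialDataSet (𝓡 3) X) : Prop :=
  (∃ 𝒟 : VacuumCauchyDevelopment D, 𝒟.IsMaximal) ∧
    ∀ 𝒟 : VacuumCauchyDevelopment D, 𝒟.IsMaximal → SettlesAtT 𝒟

/-- The tame-WCC part of `P_T`: an MGHD exists and every MGHD has complete `𝓘⁺`. -/
def CensoredMGHD (D : InitialDataSet (𝓡 3) X) : Prop :=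
  (∃ 𝒟 : VacuumCauchyDevelopment D, 𝒟.IsMaximal) ∧
    ∀ 𝒟 : VacuumCauchyDevelopment D, 𝒟.IsMaximal → HasCompleteNullInfinity 𝒟.toCauchyDevelopment

omit [TopologicalSpace X] [ChartedSpace E3 X] [IsManifold (𝓡 3) ∞ X] [ConnectedSpace X] in
/-- `P_T` implies the WCC part pointwise. -/
theorem censoredMGHD_of_settlesHonestlyT [TopologicalSpace X] [ChartedSpace E3 X]
    [IsManifold (𝓡 3) ∞ X] [ConnectedSpace X] {D : InitialDataSet (𝓡 3) X}
    (h : SettlesHonestlyT D) : CensoredMGHD D :=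
  ⟨h.1, fun 𝒟 h𝒟 ↦ (h.2 𝒟 h𝒟).1⟩

end Pointwise

/-- The crux with the tame codimension as a parameter. -/
def TameCodimT (m : ℕ) : Prop :=
  ∀ (X : Type) [TopologicalSpace X] [ChartedSpace E3 X] [IsManifold (𝓡 3) ∞ X] [T2Space X]
    [SecondCountableTopology X] [ConnectedSpace X],
    InitialDataSet.IsTameChristodoulouGeneric (admissibleVacuumData X) SettlesHonestlyT m

/-- READ-BACK: the crux is `TameCodimT 1`, definitionally (the let-bound predicates zeta-reduce to the
named ones). -/
theorem T_iff_tameCodimT_one : HonestFixedRadiusSettlingT ↔ TameCodimT 1 := Iff.rfl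

/-! ### §1 Shape of any kill (tame genericity) -/

section Genericity

variable {Y : Type*} [TopologicalSpace Y] [ChartedSpace E3 Y] [IsManifold (𝓡 3) ∞ Y]

/-- Unfolding: failure of TAME Christodoulou genericity is an exceptional datum through which every tame
(one fixed sole end), immersed-at-`0`, injective admissible `m`-parameter family has another exceptional
member. Compared with the rev-1 kill shape the refuter's burden is LIGHTER (fewer families to defeat). -/
theorem not_isTameChristodoulouGeneric_iff (𝓓 : Set (InitialDataSet (𝓡 3) Y))
    (P : InitialDataSet (𝓡 3) Y → Prop) (m : ℕ) :
    ¬ InitialDataSet.IsTameChristodoulouGeneric 𝓓 P m ↔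
      ∃ d ∈ 𝓓, ¬ P d ∧ ∀ (e : AFEnd Y) (F : EuclideanSpace ℝ (Fin m) → InitialDataSet (𝓡 3) Y),
        InitialDataSet.IsTameDataFamily e m F → InitialDataSet.IsImmersedAtZero m F → F 0 = d →
          Function.Injective F → (∀ c, F c ∈ 𝓓) → ∃ c ≠ 0, ¬ P (F c) := by
  constructor
  · intro h
    by_contra hcon
    apply h
    intro d hd
    by_contra hnot
    apply hcon
    refine ⟨d, hd.1, hd.2, fun e F hF himm h0 hinj hmem ↦ ?_⟩
    by_contra hc
    push Not at hc
    exact hnot ⟨e, F, hF, himm, h0, hinj, hmem, fun c hc' hE ↦ hE.2 (hc c hc')⟩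
  · rintro ⟨d, hd, hP, h⟩ hgen
    obtain ⟨e, F, hF, himm, h0, hinj, hmem, hE⟩ := hgen d ⟨hd, hP⟩
    obtain ⟨c, hc, hPc⟩ := h e F hF himm h0 hinj hmem
    exact hE c hc ⟨hmem c, hPc⟩

/-- A nonzero parameter exists as soon as `0 < m`. -/
theorem exists_ne_zero_euclideanSpace {m : ℕ} (hm : 0 < m) : ∃ c : EuclideanSpace ℝ (Fin m), c ≠ 0 := by
  refine ⟨EuclideanSpace.single ⟨0, hm⟩ 1, fun h ↦ ?_⟩
  have := congrArg (fun v : EuclideanSpace ℝ (Fin m) ↦ v ⟨0, hm⟩) h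
  simp at this

/-- Sufficient kill shape: a nonempty admissible class on which `P` fails everywhere refutes tame
genericity in every positive codimension. -/
theorem not_isTameChristodoulouGeneric_of_forall_not {𝓓 : Set (InitialDataSet (𝓡 3) Y)}
    {P : InitialDataSet (𝓡 3) Y → Prop} {m : ℕ} (hm : 0 < m) (hne : 𝓓.Nonempty)
    (h : ∀ d ∈ 𝓓, ¬ P d) : ¬ InitialDataSet.IsTameChristodoulouGeneric 𝓓 P m := by
  intro hgen
  obtain ⟨d, hd⟩ := hne
  obtain ⟨-, F, -, -, -, -, hmem, hE⟩ := hgen d ⟨hd, h d hd⟩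
  obtain ⟨c, hc⟩ := exists_ne_zero_euclideanSpace hm
  exact hE c hc ⟨hmem c, h _ (hmem c)⟩

/-- Vacuity: an empty admissible class makes every property tame-generic. -/
theorem isTameChristodoulouGeneric_of_eq_empty {𝓓 : Set (InitialDataSet (𝓡 3) Y)} (h𝓓 : 𝓓 = ∅)
    (P : InitialDataSet (𝓡 3) Y → Prop) (m : ℕ) : InitialDataSet.IsTameChristodoulouGeneric 𝓓 P m := by
  intro d hd
  rw [h𝓓] at hd
  exact absurd hd.1 (Set.notMem_empty d)

/-- TAME codimension `0` is free for every property on a class all of whose members have a sole strongly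
asymptotically flat end (the constant family is tame; immersion, injectivity and "only at `0`" are vacuous
on the one-point parameter space `ℝ⁰`). -/
theorem isTameChristodoulouGeneric_zero {𝓓 : Set (InitialDataSet (𝓡 3) Y)}
    (h𝓓 : ∀ d ∈ 𝓓, ∃ e : AFEnd Y, e.IsSoleEnd ∧ ∃ M : ℝ, e.IsStronglyAsymptoticallyFlatDR d M)
    (P : InitialDataSet (𝓡 3) Y → Prop) : InitialDataSet.IsTameChristodoulouGeneric 𝓓 P 0 := by
  intro d hd
  obtain ⟨e, hsole, M, hM⟩ := h𝓓 d hd.1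
  refine ⟨e, fun _ ↦ d, InitialDataSet.isTameDataFamily_const hsole 0 hM, ?_, rfl, ?_, fun _ ↦ hd.1, ?_⟩
  · intro v hv
    exact absurd (Subsingleton.elim v 0) hv
  · intro a b _
    exact Subsingleton.elim a b
  · intro c hc
    exact absurd (Subsingleton.elim c 0) hc

/-- **EDIT (1) is load-bearing against receding families.** A family whose scalar components
`c ↦ h_c(x)(u,w)`, `c ↦ k_c(x)(u,w)` are, at EVERY point and pair of vectors, eventually constant as
`c → 0` — e.g. a family that agrees with its base datum on every compact set for `‖c‖` small (a pure
far-field "broom" cleaning the datum beyond radius `1/‖c‖`, or the rev-1 exact-Kerr burial beyond a receding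
radius) — is NOT immersed at `0`. Hence every `T`-witness curve has a non-zero first-order LOCAL perturbation
direction `dF/dc(0)`: brooms must come with kicks. (Companion: mass blow-up is excluded by `wDist`,
`WeakCosmicCensorshipTame.Negative.TameMassContinuity.not_isTameDataFamily_of_mass_tendsto_atTop`; a receding
modification WITH a kick and bounded mass is excluded by neither — that is the broom + kick arc of §5(a).) -/
theorem not_isImmersedAtZero_of_eventuallyEq {m : ℕ} (hm : m ≠ 0)
    {F : EuclideanSpace ℝ (Fin m) → InitialDataSet (𝓡 3) Y}
    (hh : ∀ (x : Y) (u w : TangentSpace (𝓡 3) x),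
      (fun c ↦ (F c).h.inner x u w) =ᶠ[𝓝 0] fun _ ↦ (F 0).h.inner x u w)
    (hk : ∀ (x : Y) (u w : TangentSpace (𝓡 3) x),
      (fun c ↦ (F c).k x u w) =ᶠ[𝓝 0] fun _ ↦ (F 0).k x u w) :
    ¬ InitialDataSet.IsImmersedAtZero m F := by
  intro himm
  obtain ⟨x, u, w, huw⟩ := himm (EuclideanSpace.single ⟨0, Nat.pos_of_ne_zero hm⟩ 1) (by simp)
  rcases huw with huw | huw
  · apply huw
    rw [(hh x u w).fderiv_eq]
    simp
  · apply huw
    rw [(hk x u w).fderiv_eq]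
    simp

end Genericity

/-- KILL SHAPE for the crux: one `X` with a nonempty admissible class on which `SettlesHonestlyT`
fails identically. (Unreachable in the tree: `SettlesHonestlyT` of trivial data is expected TRUE, §3.) -/
theorem not_T_of_forall_not (X : Type) [TopologicalSpace X] [ChartedSpace E3 X]
    [IsManifold (𝓡 3) ∞ X] [T2Space X] [SecondCountableTopology X] [ConnectedSpace X]
    (hne : (admissibleVacuumData X).Nonempty)
    (h : ∀ D ∈ admissibleVacuumData X, ¬ SettlesHonestlyT D) : ¬ HonestFixedRadiusSettlingT :=
  fun hS ↦ not_isTameChristodoulouGeneric_of_forall_not one_pos hne h (hS X)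

/-- The same on `X = ℝ³`, whose admissible class is nonempty (`trivialData_mem_admissibleVacuumData`), so
the crux is not vacuous there. -/
theorem not_T_of_forall_not_slice
    (h : ∀ D ∈ admissibleVacuumData Minkowski.slice, ¬ SettlesHonestlyT D) :
    ¬ HonestFixedRadiusSettlingT :=
  not_T_of_forall_not Minkowski.slice ⟨_, trivialData_mem_admissibleVacuumData⟩ h

/-- `TameCodimT 0` holds outright: the `1` in the crux is its whole content. -/
theorem tameCodimT_zero : TameCodimT 0 := fun _ _ _ _ _ _ _ ↦
  isTameChristodoulouGeneric_zero (fun _ hd ↦ exists_isSoleEnd_of_mem_admissibleVacuumData hd) _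

/-! ### §2 What the crux contains (monotonicity) -/

/-- `T` implies the TAME weak cosmic censorship item of route PhaseMixingCapture
(`stmt-FinalStateConjecture-17269`: tame-generic MGHD existence + complete `𝓘⁺`). -/
theorem tameWCC_of_T (h : HonestFixedRadiusSettlingT) :
    Summit.FinalStateConjecture.FinalStateConjecture.Theses.PhaseMixingCapture.WeakCosmicCensorshipTame := by
  intro X _ _ _ _ _ _
  exact (h X).mono fun D _ hD ↦ censoredMGHD_of_settlesHonestlyT hD

/-- NEGATIVE LEMMA modulo ¬(tame WCC): any disproof of tame weak cosmic censorship kills the crux. -/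
theorem T_false_of_not_tameWCC
    (h : ¬ Summit.FinalStateConjecture.FinalStateConjecture.Theses.PhaseMixingCapture.WeakCosmicCensorshipTame) :
    ¬ HonestFixedRadiusSettlingT :=
  fun hS ↦ h (tameWCC_of_T hS)

/-- `T` implies the rev-1 crux (landed p131688; every rev-1 Disproof / Negative lemma tests `T`). -/
theorem old_of_T (h : HonestFixedRadiusSettlingT) : HonestFixedRadiusSettling :=
  Summit.FinalStateConjecture.FinalStateConjecture.Theorems.StarvedNecks.Retype.honestFixedRadiusSettling_of_T h

/-- The crux WITHOUT edit (3) (= `RetypeKitC5.HonestFixedRadiusSettlingT`, ideator-1's `T0`). -/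
def T0 : Prop :=
  ∀ (X : Type) [TopologicalSpace X] [ChartedSpace E3 X] [IsManifold (𝓡 3) ∞ X] [T2Space X]
    [SecondCountableTopology X] [ConnectedSpace X],
    InitialDataSet.IsTameChristodoulouGeneric (admissibleVacuumData X)
      (fun D ↦ (∃ 𝒟 : VacuumCauchyDevelopment D, 𝒟.IsMaximal) ∧
        ∀ 𝒟 : VacuumCauchyDevelopment D, 𝒟.IsMaximal →
          HasCompleteNullInfinity 𝒟.toCauchyDevelopment ∧
            ∃ (O : Set 𝒟.carrier) (d : FinalStateDecomposition 𝒟.toSpacetime O 4) (R₀ : ℝ),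
              O = exteriorOf 𝒟.toCauchyDevelopment d.charted ∧
                RaysStayInClosure 𝒟.toCauchyDevelopment O ∧
                  HonestCore 𝒟.toSpacetime O 4 d R₀ ∧ HonestFar 𝒟.toSpacetime O 4 d R₀) 1

/-- `T → T0` (drop the velocity conjunct). The converse needs the parabolic / comoving pairs to be
tame-codimension-1 (ideator-1's `ParabolicCure`). -/
theorem T0_of_T (h : HonestFixedRadiusSettlingT) : T0 := by
  intro X _ _ _ _ _ _
  refine (h X).mono fun D _ hD ↦ ⟨hD.1, fun 𝒟 h𝒟 ↦ ?_⟩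
  obtain ⟨hscri, O, d, R₀, hO, hrays, hcore, hfar, -⟩ := hD.2 𝒟 h𝒟
  exact ⟨hscri, O, d, R₀, hO, hrays, hcore, hfar⟩

/-- The rays clause alone, tame-generically: every MGHD carries SOME `C⁴` decomposition of its
self-determined exterior containing every future-complete normalised null ray up to closure. -/
def RaysGeneric : Prop :=
  ∀ (X : Type) [TopologicalSpace X] [ChartedSpace E3 X] [IsManifold (𝓡 3) ∞ X] [T2Space X]
    [SecondCountableTopology X] [ConnectedSpace X],
    InitialDataSet.IsTameChristodoulouGeneric (admissibleVacuumData X)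
      (fun D ↦ ∀ 𝒟 : VacuumCauchyDevelopment D, 𝒟.IsMaximal →
        ∃ (O : Set 𝒟.carrier) (d : FinalStateDecomposition 𝒟.toSpacetime O 4),
          O = exteriorOf 𝒟.toCauchyDevelopment d.charted ∧ RaysStayInClosure 𝒟.toCauchyDevelopment O) 1

/-- `T → RaysGeneric`: a hidden second infinity that is tame-stably present (BN-4-4, `M # ℝ³`) kills `T`
through this corollary alone. -/
theorem raysGeneric_of_T (h : HonestFixedRadiusSettlingT) : RaysGeneric := by
  intro X _ _ _ _ _ _
  refine (h X).mono fun D _ hD 𝒟 h𝒟 ↦ ?_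
  obtain ⟨-, O, d, R₀, hO, hrays, -⟩ := hD.2 𝒟 h𝒟
  exact ⟨O, d, hO, hrays⟩


/-! ### §3 The new clauses on the flat model class (census over the landed `SubMinkowski` battery)

The tree certifies exactly one family of vacuum Cauchy developments of an admissible datum: the open
sub-developments `η|_U` of the TRIVIAL datum on `X = ℝ³` (`SubMinkowski.subDev U hU hsl hC`: `U ⊆ ℝ⁴` open,
connected, containing the slice `{x⁰ = 0}` as a Cauchy hypersurface). On this class the universal conjunct
`SettlesAtT` of `P_T` is decided completely: it holds iff `{x⁰ ≥ 0} ⊆ U` iff `𝓘⁺` is complete. -/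

section FlatClass

open Summit.FinalStateConjecture.FinalStateConjecture.Theorems.ChannelsResolveTameDevelopmentsR.SubMinkowski
open Literature.Geometry.Lorentzian.Minkowski TopologicalSpace

variable {U : Opens E4} {hU : IsConnected (U : Set E4)} {hsl : ∀ y : slice, sliceEmbed y ∈ U}
  {hC : (subMetric U).IsCauchyHypersurface (subOrientation U)
    (range (vacuumCauchyDevelopment.embedOpens U hsl))}

/-- The honest `N = 0` decomposition IN `Cᵏ` (every `k`; the crux asks `k = 4`) of the future half-space
`O = {x⁰ ≥ 0}` of `η|_U`, when `{x⁰ ≥ 0} ⊆ U`: the battery's `subDecomp` with the regularity made a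
parameter (the inclusion chart has deviation `0`, so `k` is idle). -/
def subDecompK (k : ℕ) (hfut : {x : E4 | 0 ≤ x 0} ⊆ (U : Set E4)) :
    FinalStateDecomposition (subDev U hU hsl hC).toSpacetime (futureSet U) k where
  N := 0
  mass := Fin.elim0
  spin := Fin.elim0
  mass_pos i := i.elim0
  abs_spin_le_mass i := i.elim0
  motion := Fin.elim0
  τ₀ := 1
  chart i := i.elim0
  isLateChart i := i.elim0
  tendsto_truncDeviationCk i := i.elim0
  exists_pairwise_disjoint _ := ⟨0, fun i ↦ i.elim0⟩
  excision := Fin.elim0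
  tendsto_excision_div i := i.elim0
  flatDomain := flatDom
  setOf_lt_excision_subset_flatDomain x hx := (zero_lt_one.trans hx.1 : (0 : ℝ) < x 0)
  flatChart := Opens.inclusion (flatDom_le hfut)
  isLateChart_flat := by
    refine ⟨contMDiff_inclusion (flatDom_le hfut), ?_, ?_⟩
    · have hlate : IsOpen ((Minkowski.backgroundOn flatDom).lateRegion 1) :=
        isOpen_lt continuous_const ((PiLp.continuous_apply 2 _ 0).comp continuous_subtype_val)
      exact (Opens.isOpenEmbedding_of_le (flatDom_le hfut)).comp (IsOpen.isOpenEmbedding_subtypeVal hlate)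
    · rintro _ ⟨y, hy, rfl⟩
      show (0 : ℝ) ≤ (y : E4) 0
      exact zero_le_one.trans (le_of_lt hy)
  tendsto_deviationCk_flat := by
    have h : ∀ τ, (subDev U hU hsl hC).toSpacetime.deviationCk (Minkowski.backgroundOn flatDom)
        (Opens.inclusion (flatDom_le hfut)) k τ = 0 := fun τ ↦ by
      rw [Spacetime.deviationCk, deviationExtend_inclusion hfut, supCkENorm_zero]
    exact tendsto_const_nhds.congr fun τ ↦ (h τ).symm
  diff_subset_causalPast := by
    intro x hx
    change U at x
    have hx0 : (0 : ℝ) ≤ (x : E4) 0 := hx.1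
    have hxle : (x : E4) 0 ≤ 1 := by
      refine not_lt.mp fun hlt ↦ hx.2 (Or.inr ?_)
      exact ⟨⟨(x : E4), show (0 : ℝ) < (x : E4) 0 from zero_lt_one.trans hlt⟩, hlt, rfl⟩
    refine LorentzianMetric.causalFuture_mono ?_ (mem_causalPast_slab_of_time_le hfut hx0 hxle)
    intro z hz
    change U at z
    have hz' : (z : E4) 0 = 1 := hz
    exact Or.inr ⟨⟨(z : E4), show (0 : ℝ) < (z : E4) 0 by rw [hz']; exact zero_lt_one⟩, hz', rfl⟩

/-- `subDecompK` has no hole. -/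
theorem subDecompK_N (k : ℕ) (hfut : {x : E4 | 0 ≤ x 0} ⊆ (U : Set E4)) :
    (subDecompK (hU := hU) (hsl := hsl) (hC := hC) k hfut).N = 0 := rfl

/-- The charted late region of `subDecompK` is `{x⁰ > 1}`. -/
theorem charted_subDecompK (k : ℕ) (hfut : {x : E4 | 0 ≤ x 0} ⊆ (U : Set E4)) :
    (subDecompK (hU := hU) (hsl := hsl) (hC := hC) k hfut).charted = {z : U | 1 < (z : E4) 0} := by
  refine Set.ext fun (z : U) ↦ ?_
  rw [FinalStateDecomposition.charted, FinalStateDecomposition.radiationZone]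
  constructor
  · rintro (⟨y, hy, rfl⟩ | ⟨_, ⟨i, rfl⟩, _⟩)
    · exact hy
    · exact i.elim0
  · intro hz
    exact Or.inl ⟨⟨(z : E4), show (0 : ℝ) < (z : E4) 0 from zero_lt_one.trans hz⟩, hz, rfl⟩

/-- `O = {x⁰ ≥ 0}` is the self-determined exterior of `subDecompK`. -/
theorem futureSet_eq_exteriorOf_subDecompK (k : ℕ) (hfut : {x : E4 | 0 ≤ x 0} ⊆ (U : Set E4)) :
    futureSet U = exteriorOf (subDev U hU hsl hC).toCauchyDevelopment
      (subDecompK (hU := hU) (hsl := hsl) (hC := hC) k hfut).charted := by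
  rw [charted_subDecompK, ← charted_subDecomp hfut]
  exact futureSet_eq_exteriorOf hfut

/-- `HonestCore` holds for `subDecompK` (every `R₀`): C1–C3 are vacuous and the inclusion pushes `∂₀`
forward to `∂ₜ|_U`, which is future-directed. -/
theorem honestCore_subDecompK (k : ℕ) (hfut : {x : E4 | 0 ≤ x 0} ⊆ (U : Set E4)) (R₀ : ℝ) :
    HonestCore (subDev U hU hsl hC).toSpacetime (futureSet U) k (subDecompK k hfut) R₀ := by
  refine ⟨fun i ↦ i.elim0, fun i ↦ i.elim0, fun i ↦ i.elim0, fun y _ ↦ ?_⟩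
  change (subDev U hU hsl hC).timeOrientation.IsFutureDirected
    (mfderiv 𝓘(ℝ, E4) (𝓡 4) (Opens.inclusion (flatDom_le hfut)) y (E4.basisVector 0))
  rw [show mfderiv 𝓘(ℝ, E4) (𝓡 4) (Opens.inclusion (flatDom_le hfut)) y (E4.basisVector 0) =
      E4.basisVector 0 from OpensChart.mfderiv_inclusion_apply (flatDom_le hfut) y (E4.basisVector 0)]
  exact (subDev U hU hsl hC).timeOrientation.isFutureDirected_vectorField _

/-- `HonestFar` holds for `subDecompK` (every `R₀`): a flat-late point `1 < x⁰ < τ₂` lies below the slab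
`{x⁰ = τ₂}` within `U` (`mem_causalPast_slab_of_time_le`), the late half-spaces `{τ' ≤ x⁰}` are closed in
`U`, and F3 is vacuous. -/
theorem honestFar_subDecompK (k : ℕ) (hfut : {x : E4 | 0 ≤ x 0} ⊆ (U : Set E4)) (R₀ : ℝ) :
    HonestFar (subDev U hU hsl hC).toSpacetime (futureSet U) k (subDecompK k hfut) R₀ := by
  refine ⟨?_, ?_, fun i ↦ i.elim0⟩
  · rintro τ₂ (hτ₂ : (1 : ℝ) < τ₂) _ ⟨y, ⟨hy₁, hy₂⟩, rfl⟩
    have hy₁' : (1 : ℝ) < (y : E4) 0 := hy₁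
    have hy₂' : (y : E4) 0 < τ₂ := hy₂
    have hx0 : (0 : ℝ) ≤ ((Opens.inclusion (flatDom_le hfut) y : U) : E4) 0 :=
      zero_le_one.trans (le_of_lt hy₁')
    have hxle : ((Opens.inclusion (flatDom_le hfut) y : U) : E4) 0 ≤ τ₂ := le_of_lt hy₂'
    refine LorentzianMetric.causalFuture_mono ?_ (mem_causalPast_slab_of_time_le hfut hx0 hxle)
    intro z hz
    change U at z
    have hz' : (z : E4) 0 = τ₂ := hz
    exact ⟨⟨(z : E4), show (0 : ℝ) < (z : E4) 0 by rw [hz']; exact zero_lt_one.trans hτ₂⟩, hz', rfl⟩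
  · intro τ' hτ'
    have hτ'' : (1 : ℝ) < τ' := hτ'
    have himg : (Opens.inclusion (flatDom_le hfut) '' {y : flatDom | τ' ≤ (y : E4) 0} : Set U) =
        {z : U | τ' ≤ (z : E4) 0} := by
      refine Set.ext fun (z : U) ↦ ⟨?_, fun hz ↦ ?_⟩
      · rintro ⟨y, hy, rfl⟩
        exact hy
      · exact ⟨⟨(z : E4), show (0 : ℝ) < (z : E4) 0 from
          (zero_lt_one.trans hτ'').trans_le hz⟩, hz, rfl⟩
    have hcl : IsClosed ({z : U | τ' ≤ (z : E4) 0} : Set U) :=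
      isClosed_le continuous_const ((PiLp.continuous_apply 2 _ 0).comp continuous_subtype_val)
    refine (closure_mono (Set.image_mono fun y hy ↦ hy.1)).trans ?_
    change closure (Opens.inclusion (flatDom_le hfut) '' {y : flatDom | τ' ≤ (y : E4) 0} : Set U) ⊆
      Opens.inclusion (flatDom_le hfut) '' {y : flatDom | τ' ≤ (y : E4) 0}
    rw [himg]
    exact hcl.closure_subset

/-- EDIT (3) is vacuous for `subDecompK` (`N = 0`). -/
theorem distinctVelocities_subDecompK (k : ℕ) (hfut : {x : E4 | 0 ≤ x 0} ⊆ (U : Set E4)) :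
    DistinctVelocities (subDecompK (hU := hU) (hsl := hsl) (hC := hC) k hfut) := fun i ↦ i.elim0

/-- EDIT (2) HOLDS ON THE WHOLE FLAT CLASS, complete or not (re-export of the battery's
`raysStayInClosure_futureSet`): every normalised null ray of `η|_U` from the slice is a straight null line
with unit time component, so it stays in `{x⁰ ≥ 0}`. The rays clause does NOT detect time truncation. -/
theorem raysStayInClosure_subDev :
    RaysStayInClosure (subDev U hU hsl hC).toCauchyDevelopment (futureSet U) :=
  raysStayInClosure_futureSet

/-- **If `{x⁰ ≥ 0} ⊆ U` then `η|_U` T-SETTLES**: complete `𝓘⁺` and the honest `C⁴` decomposition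
`subDecompK 4` of `O = {x⁰ ≥ 0} = exteriorOf` with the rays clause, `HonestCore`, `HonestFar` (any `R₀`; here
`0`) and (vacuously) distinct velocities. -/
theorem settlesAtT_of_future_subset (hfut : {x : E4 | 0 ≤ x 0} ⊆ (U : Set E4)) :
    SettlesAtT (subDev U hU hsl hC) :=
  ⟨hasCompleteNullInfinity_of_future_subset hfut, futureSet U, subDecompK 4 hfut, 0,
    futureSet_eq_exteriorOf_subDecompK 4 hfut, raysStayInClosure_subDev, honestCore_subDecompK 4 hfut 0,
    honestFar_subDecompK 4 hfut 0, distinctVelocities_subDecompK 4 hfut⟩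

/-- **CENSUS OF `P_T`'S UNIVERSAL CONJUNCT ON THE FLAT CLASS.** `SettlesAtT (η|_U) ↔ {x⁰ ≥ 0} ⊆ U`:
(→) by the completeness clause alone (`hasCompleteNullInfinity_iff_future_subset`); (←)
`settlesAtT_of_future_subset`. -/
theorem settlesAtT_iff_future_subset :
    SettlesAtT (subDev U hU hsl hC) ↔ {x : E4 | 0 ≤ x 0} ⊆ (U : Set E4) :=
  ⟨fun h ↦ hasCompleteNullInfinity_iff_future_subset.1 h.1, settlesAtT_of_future_subset⟩

/-- **On the certifiable class ALL of `T`'s decomposition clauses are idle relative to complete `𝓘⁺`:**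
`SettlesAtT (η|_U) ↔ HasCompleteNullInfinity (η|_U)`. Regularity `k = 4`, `HonestCore`, `HonestFar`,
`O = exteriorOf`, the rays clause and distinct velocities carry no independent load at `N = 0`; the three
edits change nothing in the flat-class picture of 13550. -/
theorem settlesAtT_iff_hasCompleteNullInfinity :
    SettlesAtT (subDev U hU hsl hC) ↔ HasCompleteNullInfinity (subDev U hU hsl hC).toCauchyDevelopment :=
  settlesAtT_iff_future_subset.trans hasCompleteNullInfinity_iff_future_subset.symm

end FlatClass

section FlatClassConsequences

open Summit.FinalStateConjecture.FinalStateConjecture.Theorems.ChannelsResolveTameDevelopmentsR.SubMinkowski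

/-- **A NON-MAXIMAL development T-settles**: the past cut `{x⁰ > −1}` of Minkowski space. So the guard
`IsMaximal →` cannot be replaced by nothing AND the conclusion cannot single out the maximal development. -/
theorem settlesAtT_pastCutDev : SettlesAtT pastCutDev :=
  settlesAtT_of_future_subset future_subset_pastCut

/-- Non-vacuity of "`P_T` without `IsMaximal`, guarded by complete `𝓘⁺`". -/
theorem exists_settlesAtT_not_isMaximal :
    ∃ 𝒟 : VacuumCauchyDevelopment trivialData, ¬ 𝒟.IsMaximal ∧ SettlesAtT 𝒟 :=
  ⟨pastCutDev, pastCutDev_not_isMaximal, settlesAtT_pastCutDev⟩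

/-- **The time truncation `{x⁰ < 1}` does NOT T-settle** (its `𝓘⁺` is incomplete; landed
`WeakCosmicCensorshipMGHD.Negative.not_hasCompleteNullInfinity_truncated`). -/
theorem not_settlesAtT_truncated :
    ¬ SettlesAtT Summit.FinalStateConjecture.FinalStateConjecture.Theorems.WeakCosmicCensorshipMGHD.Negative.truncated :=
  fun h ↦ Summit.FinalStateConjecture.FinalStateConjecture.Theorems.WeakCosmicCensorshipMGHD.Negative.not_hasCompleteNullInfinity_truncated h.1

/-- **`P_T` without the maximality guard FAILS at the admissible trivial datum** (whereas with the guard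
replaced by complete `𝓘⁺` every clause holds on the flat class, `settlesAtT_iff_hasCompleteNullInfinity`):
any proof of `T` must use `𝒟.IsMaximal`, at least to exclude truncations — exactly as for 13550. -/
theorem settlesHonestlyT_false_without_isMaximal :
    ¬ ((∃ 𝒟 : VacuumCauchyDevelopment trivialData, 𝒟.IsMaximal) ∧
        ∀ 𝒟 : VacuumCauchyDevelopment trivialData, SettlesAtT 𝒟) :=
  fun h ↦ not_settlesAtT_truncated (h.2 _)

/-- The crux with the guard `𝒟.IsMaximal →` deleted, tame codimension as a parameter. -/
def TameCodimTWithoutIsMaximal (m : ℕ) : Prop :=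
  ∀ (X : Type) [TopologicalSpace X] [ChartedSpace E3 X] [IsManifold (𝓡 3) ∞ X] [T2Space X]
    [SecondCountableTopology X] [ConnectedSpace X],
    InitialDataSet.IsTameChristodoulouGeneric (admissibleVacuumData X)
      (fun D ↦ (∃ 𝒟 : VacuumCauchyDevelopment D, 𝒟.IsMaximal) ∧ ∀ 𝒟 : VacuumCauchyDevelopment D, SettlesAtT 𝒟) m

/-- Codimension `0` of the unguarded statement is still free. -/
theorem tameCodimTWithoutIsMaximal_zero : TameCodimTWithoutIsMaximal 0 := fun _ _ _ _ _ _ _ ↦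
  isTameChristodoulouGeneric_zero (fun _ hd ↦ exists_isSoleEnd_of_mem_admissibleVacuumData hd) _

/-- The unguarded crux is STRONGER than the crux (tame genericity is monotone in the property). -/
theorem T_of_tameCodimTWithoutIsMaximal_one (h : TameCodimTWithoutIsMaximal 1) : HonestFixedRadiusSettlingT := by
  rw [T_iff_tameCodimT_one]
  intro X _ _ _ _ _ _
  exact (h X).mono fun _ _ hD ↦ ⟨hD.1, fun 𝒟 _ ↦ hD.2 𝒟⟩

/-- What the unguarded crux would demand at the trivial datum: a TAME immersed injective admissible curve
through it ALL of whose other members T-settle at EVERY vacuum Cauchy development — in particular have only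
complete-`𝓘⁺` developments (absurd on paper: truncate in time; not refutable in a tree that constructs no
development of a non-trivial datum). -/
theorem tameCodimTWithoutIsMaximal_one_obligation (h : TameCodimTWithoutIsMaximal 1) :
    ∃ (e : AFEnd Minkowski.slice) (F : EuclideanSpace ℝ (Fin 1) → InitialDataSet (𝓡 3) Minkowski.slice),
      InitialDataSet.IsTameDataFamily e 1 F ∧ InitialDataSet.IsImmersedAtZero 1 F ∧ F 0 = trivialData ∧
        Function.Injective F ∧ (∀ c, F c ∈ admissibleVacuumData Minkowski.slice) ∧
        ∀ c, c ≠ 0 → ∀ 𝒟 : VacuumCauchyDevelopment (F c), HasCompleteNullInfinity 𝒟.toCauchyDevelopment := by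
  obtain ⟨e, F, hF, himm, h0, hinj, hmem, hE⟩ := h Minkowski.slice trivialData
    ⟨trivialData_mem_admissibleVacuumData, settlesHonestlyT_false_without_isMaximal⟩
  refine ⟨e, F, hF, himm, h0, hinj, hmem, fun c hc 𝒟 ↦ ?_⟩
  by_contra hcon
  exact hE c hc ⟨hmem c, fun hP ↦ hcon (hP.2 𝒟).1⟩

end FlatClassConsequences

/-! ### §4 Edit (3): the distinct-velocity conjunct -/

/-- EDIT (3) is vacuous for `N ≤ 1`; it bites only from two holes on. What it excludes for `N ≥ 2` is a pair
with equal asymptotic four-velocity and sublinearly growing separation (the structure's own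
`exists_pairwise_disjoint` already excludes comoving pairs at BOUNDED separation): the parabolic threshold,
codimension `1` in every model (Newtonian `E = 0`; Chazy's `HP` boundary; ideator-1's toy `pair_kick.py`),
and the witness of the rev-2 repair of NecksCertify (`ComovingPairWitness`, p73407). Unprovable either way
in the tree. -/
theorem distinctVelocities_of_N_le_one {𝓢 : Spacetime.{0} 4} {O : Set 𝓢.carrier} {k : ℕ}
    (d : FinalStateDecomposition 𝓢 O k) (h : d.N ≤ 1) : DistinctVelocities d := by
  haveI : Subsingleton (Fin d.N) := Fin.subsingleton_iff_le_one.2 h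
  exact fun i j hij ↦ absurd (Subsingleton.elim i j) hij

/-! ### §5 Why the crux resists; paper findings (documentation)

No false theorem is stated anywhere in this file: every candidate counterexample to the crux needs an
MGHD of a non-trivial admissible datum, which the tree cannot construct (MGHD existence itself is the named
fact `choquetBruhat_geroch_exists_mghd_cauchy`; no `IsMaximal` development of any datum is in the tree, so
`SettlesHonestlyT d` is neither provable nor refutable for a single `d`). What follows is the paper census
of the THREE EDITS, for the provers, ideators and the planner.

**(a) EDIT (1), tameness. Liability L1 SHARPENED (the `k = 4` over-strength, inherited from 13550 but now
interacting with `wDist`).** The admissible class controls `h` to two derivatives and `k` to one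
(`o₂(r⁻¹)`, `o₁(r⁻²)`); higher derivatives are free. Far-field TRAINS
`h = (1 + 2M/r) δ + ε r^{-α} sin(r^{1+q}) θ` (`θ` a fixed transverse-traceless pattern, Lichnerowicz-corrected
conformal factor `1 + O(ε²)`), `q > 0`, are admissible iff `α > 3 + 2q`, and then `∂ᵐh ∼ r^{-α + m q}`:
`m = 4` GROWS at spatial infinity as soon as `4q > α`. Worse, the incoming half of the train focuses: at a
FIXED radius `r ≈ R₀` and time `t`, geometric optics from radius `≈ t` gives amplitude `t^{1-α}` and
`m`-th derivatives `∼ t^{1 - α + m q}`; with `α = 3 + 2q + ε'` the exponent is `(m − 2) q − 2 − ε'`: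
`m = 2` ALWAYS decays (the summit's `k = 2` is exactly compatible with the DR class), `m = 3` grows iff
`q > 2 + ε'`, `m = 4` grows iff `q > 1 + ε'/2` (e.g. `q = 1.9`, `α = 7.3`: `∇²Riem ∼ t^{1.6} → ∞` at `r = R₀`
while the energy through the sphere is `∼ t^{2(1-α+q)} → 0`). The statement is gauge-invariant at this order
(linearised curvature), so for such a datum NO `C⁴` hole chart at fixed radius and NO `C⁴` flat chart
exists in ANY development: `P_T` fails identically on a `wDist`-DENSE subset `𝓡` of every admissible class
(add an `ε`-train to any datum; `wDist`-size `∼ ρ^{-ε'}` beyond radius `ρ`). This does NOT refute `T`: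
through `d ∈ 𝓡` the arc `G(s) = broom_{1/|s|}(d) ⊕ s f` (charge-matched gluing onto a Kerr end beyond
radius `1/|s|` — tails are little-o, so `wDist(G s, d) → 0` and `M(s) → M(0)`; jointly smooth because locally
eventually constant; PLUS a compactly supported constraint-corrected kick `s f`, WITHOUT WHICH THE ARC IS NOT
IMMERSED, `not_isImmersedAtZero_of_eventuallyEq`) leaves `𝓡` for every `s ≠ 0`, and arc-locality
(`TameGenericityLocal`) says only `0 < |s| < ε` matters. So `T` asserts, beyond the physics: (i) tame
admissible CHARGE-MATCHED `C⁴` far-field cleaning with joint smoothness in `(s, x)` (unprinted in the DR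
class; Corvino–Schoen / Mao–Oh–Tao give the elliptic step, not the `wDist`-continuity at `s = 0`), and
(ii) the full physics for the KICKED, cleaned data along one arc. Minimal repair if (i) fails: `k := 2` in
`T` — NOT free for this route: NeckGapDecay consumes `G`'s `C⁴` near-zone certificate (cylinder `C³`,
output `C²`: "one derivative = the ledger"), so `k := 2` in `G` forces the neck lever down to `C¹`/`C⁰`
output or a derivative-gaining step; the alternative is to keep `k = 4` and file the broom as an explicit
deterministic support item ("TameBroom": every admissible datum is the `wDist`-limit at `s = 0` of a jointly
smooth, charge-matched, Kerr-ended admissible arc). CLASS: a refutation along these lines would be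
`refuted-misstated` (repair `k := 2` or `+ TameBroom`), not substantive.

**(b) EDIT (2), the rays clause.** Kernel: it holds on the whole flat class (§3), so it is idle at `N = 0`
and does not see truncations. Paper: honest flat charts are RIGID — in the `1+1` reduction a flat chart with
`sup_{slab τ} ‖Φ^*η − η‖_{C⁰} → 0` has `Φ^*η = e^{2(a(u)+b(v))}(−du dv)` with `a(τ−s) + b(τ+s) → 0`
uniformly in `s ∈ ℝ`, forcing `a`, `b` constant, i.e. `Φ` Poincaré; in `3+1` the residual freedom is the
AUDIT-c4 families (sublinear drift, `log log` rotations), all with `I⁻(image) ⊇ J⁺(Σ)`. Hence the clause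
has content only where a SECOND future-complete region exists that no honest chart reaches: the BN-4-4
hidden expanding vacuum cosmology behind the neck of `X = M # ℝ³` (admissible data exist on paper by
Chruściel–Isenberg–Pollack gluing of a KID-free expanding piece to a Schwarzschild-ended exterior; the
exterior settles, the interior's future completeness — a black hole in a closed `k = −1` lattice cosmology —
is physically robust and mathematically unprinted). If real, it is TAME-STABLE (open in `C^∞_loc` + `wDist`)
and kills `T` through `raysGeneric_of_T` AND the summit alike on that `X` (summit-level finding, needs a
human ruling on the topology scope of `X`; the prior refuter's R1–R3). Not constructible: no negative lemma
modulo a precise `H` is filed this cycle because the only honest `H` is "such an `X`-datum exists with every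
MGHD hiding a complete ray from every honest `O`", i.e. `¬ RaysGeneric` restricted to one mechanism.

**(c) EDIT (3), distinct velocities.** §4.

**(d) What would a kill look like (for the next refuter).** By §1 and arc-locality: an admissible `X`,
a datum `d`, and a defect of `P_T` persisting for ALL data `C^∞_loc`-close to first order along every
immersed direction AND `wDist`-close at infinity — i.e. an OPEN region of the exceptional set in the tame
sense. Physical candidates, all unconstructible: stable naked singularities (none believed), hidden second
infinity on `M # ℝ³` (b), tame-stable `N = ∞` cascades, tame-stable extremal limits (Kehle–Unger is
codimension ≥ 1, consistent), tame-stable parabolic pairs (codimension 1, consistent). The `k = 4`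
roughness (a) is dense but NOT open (brooms). Barrier catalogue (`Literature/Barriers/FinalStateConjecture/`,
13 entries) and `ledger negatives`: no entry bites a genericity-level statement.
-/


/-! ### §6 Targets — line `Sketch` (PICKED by the lead, reshape c1, 2026-08-17T01:02Z; `Lines/Sketch.lean`)

Composition `HonestFixedRadiusSettlingT_of := T_of_Tnr (core_of_broom_of_cleanCore stub_broom stub_cleanCore)
stub_necksCertifyR E F stub_settledExteriorHoldsRays`. Open stubs of THIS crux: `stub_broom` (elliptic) and
`stub_cleanCore` (dynamical core); `stub_necksCertifyR` = item 17574 and `stub_settledExteriorHoldsRays` = item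
17673 are other seats' items (not attacked here). Verdicts of the disprover (paper; nothing kernel-checkable —
neither stub has a constructible instance, and neither is vacuous):

* `stub_broom` — CONSISTENT, NO KILL. Signature read: `∀ d ∈ 𝓓 X, ∃ e F, tame ∧ immersed ∧ F 0 = d ∧ injective ∧
  (∀ c, F c ∈ 𝓓 X) ∧ ∀ c ≠ 0, ∃ M, e.IsStronglyAsymptoticallyFlatWith (F c) M 1 2 6 5` (members off `0` clean to
  `o₆(r⁻¹)`/`o₅(r⁻²)` — enough to defuse §5(a): fixed-radius `m`-th derivatives of the focused far field are then
  `o(t^{-m})`, `m ≤ 6`). Quantifier order and typing are sound: `e` per datum (not per member) as tameness wants; `M`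
  per member is harmless (`TameMassContinuity`: `M(c) → M(0)` is forced by `wDist` anyway); immersion needs the kick
  (§1). Why it should be TRUE on paper even at the roughest DR data: cut the datum off to its charge-matched Kerr end
  across the annulus `[ρ, 2ρ]`, `ρ = 1/|c|`; every constraint violation is (derivatives of the cutoff) × (≤ 2
  derivatives of `d − Kerr`), of scale-invariant size `≤ ρ²(|∂²s| + |∂s|/ρ + |s|/ρ²) = o(ρ⁻¹)` in the DR class, and
  the conformal / vector corrections have weighted `C²`/`C¹` norms of the same order (high-frequency sources even gain
  `ω⁻²`; a `log`-loss in the pointwise elliptic estimate is beaten by the power): for the far-field trains of §5(a),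
  `wDist(F c, d) ≲ ρ^{-ε'} + ρ^{2-α+q} log ρ → 0`. The removed train itself dominates. Printed support: Corvino–Schoen
  density of Kerr-ended ("harmonic asymptotics") vacuum data in weighted Sobolev topologies — for data with MORE
  weighted derivatives than DR; the DR-pointwise, jointly-smooth-in-`c`, kicked version is unprinted (the lead's
  BN-17575-2-3). A kill would need an admissible datum whose every tame arc keeps rough members — implausible by the
  estimate above. (`lit search` was degraded in this session — searchd down, arXiv 429 — so no page citation is added.)
* `stub_cleanCore` — = tame weak cosmic censorship + finite-`N` sub-extremal Kerr final states + fixed-radius `C⁴`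
  no-hair + flat radiation zone + distinct velocities, relative to clean curves: THE OPEN PROBLEM (≥ `T_false_of_not_tameWCC`'s
  hypothesis). No instance constructible; not vacuous (constant clean curves through clean data exist on paper). Held
  by the lead by design; nothing for a disprover to do short of a counterexample to cosmic censorship.
-/

end Summit.FinalStateConjecture.FinalStateConjecture.Cruxes.HonestFixedRadiusSettlingT.Disproof

end
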